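import Summits.ResolutionOfSingularities.ResolutionOfSingularities.Theorems.MarkedTransferCampaignW46CuspStaircaseProof
import Summits.ResolutionOfSingularities.ResolutionOfSingularities.Theorems.MarkedTransferCampaignW46MohWindowBoundary
import HarnessLib

/-!
# [OURS · L1 W4.6, rung (iii)] The cusp staircase — the descent and the rung: the typed Th. 16.6 procedure terminates
# on the whole cusp family `y^b + u·x^d`, `b ∤ d` (cell res-hironaka, LADDER-RESOLUTION rung L, D-0089; slot W4.6,
# seat res-L1-s46-pv-5; host route MarkedTransfer, `--supports stmt-ResolutionOfSingularities-16155 --as helper`)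

HONEST FRAMING. Nothing here is a statement of H. Hironaka's manuscript (2017-03-23, [Hironaka2017]) and nothing here
asserts that any statement of it holds. These are THEOREMS about the OURS definitions of
`Theorems/MarkedTransferCampaignW46CuspStaircase.lean` (`Regime.cuspCurve`, `cuspMultiset`, `CuspCurveDescent`,
`CuspCurveTerminates`) over the shared typed-procedure module `Theorems/MarkedTransferCampaignW46TypedProcedure.lean`
(res-L1-type-o1; anchors `terminatesNabla_of_terminates`, res-L1-s46-pv-4's `IsCentre.subset_sing`, `Run.sing_nonempty`),
assembled from the local algebra of `…CuspStaircaseProof.lean` and this seat's window files (`MohWindow.injOn_preimage_compl`,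
`Step.exists_mem_sing_over_of_le`). The typed candidate carriers enter only as the DATA a run quantifies over (row 001
`IdealExponent.sing` / `transform`, the résumé's Def. 15.12 inclusions through the landed anchor
`IsCentre.isPermissibleCentre`). No FACT-LIST premise; no `sorry`; axioms standard. AI review is weaker than expert
review.

## The argument (what the rung banks about the architecture on K4.6's whole family)

In `Regime.cuspCurve`, `Sing(E)` is a finite set of closed points and `J_ξ` is a cusp germ `(y^b + u x^d)`, `b ∤ d`,
`b = E.b ≥ 1`, at each `ξ ∈ Sing(E)`; let `index(ξ)` be the least admissible `d` (`> b` at a singular point). (1) An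
admitted centre is a closed point `ξ ∈ Sing(E)` (`IsCentre.exists_eq_singleton_of_cuspCurve`). (2) OVER `ξ`: every
singular point `x′` of `E′` over `ξ` is again a cusp point with `index(x′) + b ≤ index(ξ)`
(`Step.cuspAt_and_cuspIndexAt_le_of_over`, from `Cusp.cuspShape_transform_of_le`). (3) OFF `ξ`: singular points of `E′`
map injectively to singular points of `E` other than `ξ`, with the same index (`Step.mem_sing_and_cuspIndexAt_eq_of_ne`).
(4) Hence the multiset of indices drops strictly in the Dershowitz–Manna order (`Step.isDershowitzMannaLT_cuspMultiset`:
common part = the off-centre points, removed part ∋ `index(ξ)`, added part = indices over `ξ`, each smaller), and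
since that order on `Multiset ℕ` is well founded (Mathlib `Multiset.wellFounded_isDershowitzMannaLT`) no run stays in
the regime forever (`terminates_cuspCurve`, every `N`, every `Rd`; ∇-centred form `terminatesNabla_cuspCurve`). The
window regime is the first landing of the staircase (`Regime.cuspCurve_of_mohWindowCurve`; every stage of a run is
singular, `Run.sing_nonempty`, so `terminates_mohWindowCurve` of `…MohWindowProof` is the special case), and outside
the window the step DOES keep a singular cusp point one stair down over the centre (`Step.exists_cuspShape_over_of_le`, refining
`Step.exists_mem_sing_over_of_le` of `…MohWindowBoundary`): the Eq. (127)-role invariant `#Sing` stalls there (K4.6: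
the typed certificate fails at step 1 for `n > 2p`) while OUR multiset invariant still drops. Characteristic and
perfectness of `K` are not used.

## References

* `Theorems/MarkedTransferCampaignW46CuspStaircase.lean` (statements), `…CuspStaircaseProof.lean`, `…MohWindow*.lean`
  (this seat); `…TypedProcedure.lean` / `…Anchors.lean` (res-L1-type-o1), `…ForcedRegime.lean` (res-L1-s46-pv-4);
  L/res-L0-k46/KILL-TEST-K4.6.md §3–§4 (kit job j258573, ALIVE, `B(p) = 2p`; rider (iv′); ATLAS-RUN j259568).
* N. Dershowitz, Z. Manna, Comm. ACM 22 (1979) 465–476 (multiset orderings), as in Mathlib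
  `Mathlib.Data.Multiset.DershowitzManna`. [folklore]
* H. Hironaka, ms. 2017-03-23, Th. 16.6 p.84 l.4–20, Th. 16.13 p.87 l.26–28, Def. 2.1 p.5 l.2–3 — scope only, under
  adjudication, not cited as fact. [Hironaka2017]
-/

noncomputable section

set_option linter.dupNamespace false -- mandated namespace of this single-conjunct summit

open CategoryTheory AlgebraicGeometry TopologicalSpace IsLocalRing

namespace Summit.ResolutionOfSingularities.ResolutionOfSingularities.Theorems

namespace CampaignW46

open Literature.AlgebraicGeometry.Resolution
open Literature.AlgebraicGeometry.Hironaka2017.S02Preliminaries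
open Literature.AlgebraicGeometry.Hironaka2017.Datum
open Scheme.IdealSheafData

universe u

/-! ## Campaign level: one step of the typed procedure on the cusp staircase -/

section Campaign

variable {n : ℕ} {p : ℕ} [Fact p.Prime] {K : Type u} [Field K] [CharP K p]
variable {N : Notions.{u} n} {A A' : AmbientDatum p K} {E : IdealExponent A.Z} {R : Resume N A E}

/-- Unfolding `cuspMultiset` at a state with finitely many singular points. [folklore] -/
theorem cuspMultiset_eq {Z : Scheme.{u}} (F : IdealExponent Z) (h : F.sing.Finite) :
    cuspMultiset F = h.toFinset.val.map (cuspIndexAt F) := by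
  unfold cuspMultiset
  rw [dif_pos h]

/-- In the regime, a centre admitted by the typed Th. 16.6 rule is a single closed point of `Sing(E)` (closed
irreducible inside the finite set of closed points `Sing(E)`). [folklore] -/
theorem IsCentre.exists_eq_singleton_of_cuspCurve {D : Closeds A.Z} (hD : IsCentre R D)
    (hRg : Regime.cuspCurve A E) :
    ∃ ξ : A.Z, ξ ∈ E.sing ∧ IsClosed ({ξ} : Set A.Z) ∧ (D : Set A.Z) = {ξ} := by
  obtain ⟨-, -, hcl, -⟩ := hRg
  have hirr := hD.irreducible
  have hgen : IsGenericPoint hirr.genericPoint (D : Set A.Z) :=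
    hirr.isGenericPoint_genericPoint D.isClosed
  have hηS : hirr.genericPoint ∈ E.sing := hD.subset_sing hgen.mem
  have hηcl : IsClosed ({hirr.genericPoint} : Set A.Z) := hcl hηS
  exact ⟨hirr.genericPoint, hηS, hηcl, hgen.def.symm.trans hηcl.closure_eq⟩

/-- [OURS · L1 W4.6 rung (iii); NOT a statement of the manuscript] **The staircase step over the centre.** For a
state in `Regime.cuspCurve` and a step `s` of the typed procedure blowing up the closed point `ξ` (`D = {ξ}`), every
point `x′ ∈ Sing(E′)` over `ξ` is again a cusp point of exponent `b` (`CuspAt`), and its cusp index has dropped by at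
least `b`: `index(x′) + b ≤ index(ξ)` — the transform of a presentation of least exponent `d₀` at `ξ` is the
presentation `(ε^b + u′ t^{d₀−b})` at the chart origin `x′` (`Cusp.cuspShape_transform_of_le`). [folklore] -/
theorem Step.cuspAt_and_cuspIndexAt_le_of_over (s : Step R A') (hRg : Regime.cuspCurve A E) {ξ : A.Z}
    (hDξ : (s.D : Set A.Z) = {ξ}) {x' : A'.Z} (hx' : x' ∈ s.E'.sing) (hπx : s.π.base x' = ξ) :
    CuspAt E.b (A'.Z.presheaf.stalk x') (stalkIdeal s.E'.J x') ∧
      cuspIndexAt s.E' x' + E.b ≤ cuspIndexAt E ξ := by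
  subst hπx
  obtain ⟨hb, -, hcl, hcusp⟩ := hRg
  haveI : IsLocallyNoetherian A'.Z := by
    haveI := A'.smooth
    exact LocallyOfFiniteType.isLocallyNoetherian A'.hom
  have hξS : s.π.base x' ∈ E.sing := by
    apply s.centre.subset_sing
    rw [hDξ]
    exact Set.mem_singleton _
  have hξcl : IsClosed ({s.π.base x'} : Set A.Z) := hcl hξS
  have hY : stalkIdeal (vanishingIdeal s.D) (s.π.base x') =
      maximalIdeal (A.Z.presheaf.stalk (s.π.base x')) := by
    apply stalkIdeal_vanishingIdeal_eq_maximalIdeal_of_closure_eq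
    rw [hDξ, hξcl.closure_eq]
  obtain ⟨hnd, hshape⟩ := Cusp.cuspIndex_spec (hcusp _ hξS)
  have hleξ : stalkIdeal E.J (s.π.base x') ≤ maximalIdeal _ ^ E.b := (le_idealOrder_iff _ _ _).mp hξS
  have hbd : E.b < cuspIndexAt E (s.π.base x') := Cusp.lt_of_cuspShape_of_le_pow hshape hnd hleξ
  have hx'b : (E.b : ℕ∞) ≤ idealOrder (controlledTransform s.π (vanishingIdeal s.D) E.J E.b) x' := hx'
  have hshape' := Cusp.cuspShape_transform_of_le s.blowup hb hbd hY hshape hx'b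
  have hnd' : ¬ E.b ∣ (cuspIndexAt E (s.π.base x') - E.b) := fun h => hnd (by
    have h2 := dvd_add h (dvd_refl E.b)
    rwa [Nat.sub_add_cancel hbd.le] at h2)
  refine ⟨⟨_, hnd', hshape'⟩, ?_⟩
  have hle : cuspIndexAt s.E' x' ≤ cuspIndexAt E (s.π.base x') - E.b := Cusp.cuspIndex_le hnd' hshape'
  omega

/-- **Off the centre nothing changes**: a singular point `x′` of `E′` not over the centre point `ξ` lies over a
singular point of `E` with the same cusp index (`π` is a local isomorphism there). [folklore] -/
theorem Step.mem_sing_and_cuspIndexAt_eq_of_ne (s : Step R A') {ξ : A.Z} (hDξ : (s.D : Set A.Z) = {ξ})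
    {x' : A'.Z} (hx' : x' ∈ s.E'.sing) (hπx : s.π.base x' ≠ ξ) :
    s.π.base x' ∈ E.sing ∧ cuspIndexAt s.E' x' = cuspIndexAt E (s.π.base x') := by
  haveI : IsLocallyNoetherian A'.Z := by
    haveI := A'.smooth
    exact LocallyOfFiniteType.isLocallyNoetherian A'.hom
  have hnot : s.π.base x' ∉ (vanishingIdeal s.D).support := by
    rw [← SetLike.mem_coe, coe_support_vanishingIdeal, hDξ]
    exact hπx
  refine ⟨?_, Cusp.cuspIndex_transform_of_not_mem_support s.blowup E.J E.b hnot⟩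
  show (E.b : ℕ∞) ≤ idealOrder E.J (s.π.base x')
  rw [← s.blowup.idealOrder_controlledTransform_eq_of_not_mem_support E.J E.b hnot]
  exact hx'

/-- [OURS · L1 W4.6 rung (iii); NOT a statement of the manuscript] **The descent.** For a state `(A, E, R)` in
`Regime.cuspCurve` and a step `s` admitted by the typed centre rule whose transform has finitely many singular
points: `cuspMultiset E′ <_{DM} cuspMultiset E` (Dershowitz–Manna). Bookkeeping: split `Sing(E′)` into the points off
the centre — they map injectively onto a part `T ⊆ Sing(E) ∖ {ξ}` with the same indices
(`Step.mem_sing_and_cuspIndexAt_eq_of_ne`, `MohWindow.injOn_preimage_compl`) — and the points over `ξ`, each of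
index `< index(ξ)` (`Step.cuspAt_and_cuspIndexAt_le_of_over`); the common part is `T`, the removed part contains
`ξ`. [folklore] -/
theorem Step.isDershowitzMannaLT_cuspMultiset (s : Step R A') (hRg : Regime.cuspCurve A E)
    (hfin' : s.E'.sing.Finite) :
    Multiset.IsDershowitzMannaLT (cuspMultiset s.E') (cuspMultiset E) := by
  classical
  obtain ⟨ξ, hξS, hξcl, hDξ⟩ := s.centre.exists_eq_singleton_of_cuspCurve hRg
  have hb : 0 < E.b := hRg.1
  have hfin : E.sing.Finite := hRg.2.1
  -- the finsets
  obtain ⟨S, hS⟩ : ∃ S : Finset A.Z, S = hfin.toFinset := ⟨_, rfl⟩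
  obtain ⟨S', hS'⟩ : ∃ S' : Finset A'.Z, S' = hfin'.toFinset := ⟨_, rfl⟩
  have hmemS : ∀ z, z ∈ S ↔ z ∈ E.sing := fun z => by rw [hS, Set.Finite.mem_toFinset]
  have hmemS' : ∀ z, z ∈ S' ↔ z ∈ s.E'.sing := fun z => by rw [hS', Set.Finite.mem_toFinset]
  set Soff := S'.filter (fun x' => s.π.base x' ≠ ξ) with hSoff
  set Sfib := S'.filter (fun x' => ¬ s.π.base x' ≠ ξ) with hSfib
  set T := Soff.image s.π.base with hT
  have hoff : ∀ x' ∈ Soff, s.π.base x' ∈ E.sing ∧ cuspIndexAt s.E' x' = cuspIndexAt E (s.π.base x') :=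
    fun x' hx' => s.mem_sing_and_cuspIndexAt_eq_of_ne hDξ ((hmemS' x').mp (Finset.mem_filter.mp hx').1)
      (Finset.mem_filter.mp hx').2
  have hfib : ∀ x' ∈ Sfib, cuspIndexAt s.E' x' < cuspIndexAt E ξ := fun x' hx' => by
    obtain ⟨h1, h2⟩ := Finset.mem_filter.mp hx'
    have h := (s.cuspAt_and_cuspIndexAt_le_of_over hRg hDξ ((hmemS' x').mp h1) (not_not.mp h2)).2
    omega
  have hinj : Set.InjOn s.π.base (Soff : Set A'.Z) := by
    refine (MohWindow.injOn_preimage_compl s.blowup).mono fun x' hx' => ?_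
    show s.π.base x' ∈ (s.D : Set A.Z)ᶜ
    rw [hDξ]
    exact (Finset.mem_filter.mp hx').2
  have hTS : T ⊆ S := by
    intro z hz
    obtain ⟨x', hx', rfl⟩ := Finset.mem_image.mp hz
    exact (hmemS _).mpr (hoff x' hx').1
  have hξT : ξ ∉ T := by
    intro hz
    obtain ⟨x', hx', hx'ξ⟩ := Finset.mem_image.mp hz
    exact (Finset.mem_filter.mp hx').2 hx'ξ
  have hξST : ξ ∈ S \ T := Finset.mem_sdiff.mpr ⟨(hmemS ξ).mpr hξS, hξT⟩
  -- the three pieces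
  have hM' : cuspMultiset s.E' = Soff.val.map (cuspIndexAt s.E') + Sfib.val.map (cuspIndexAt s.E') := by
    rw [cuspMultiset_eq _ hfin', ← hS', ← Multiset.map_add, hSoff, hSfib, Finset.filter_val, Finset.filter_val,
      Multiset.filter_add_not]
  have hX : Soff.val.map (cuspIndexAt s.E') = T.val.map (cuspIndexAt E) := by
    rw [hT, Finset.image_val_of_injOn hinj, Multiset.map_map]
    exact Multiset.map_congr rfl fun x' hx' => (hoff x' hx').2
  have hM : cuspMultiset E = T.val.map (cuspIndexAt E) + (S \ T).val.map (cuspIndexAt E) := by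
    rw [cuspMultiset_eq _ hfin, ← hS, ← Multiset.map_add, Finset.sdiff_val,
      add_tsub_cancel_of_le (Finset.val_le_iff.mpr hTS)]
  refine ⟨Soff.val.map (cuspIndexAt s.E'), Sfib.val.map (cuspIndexAt s.E'), (S \ T).val.map (cuspIndexAt E),
    ?_, hM', by rw [hM, hX], ?_⟩
  · intro h0
    have hmem : cuspIndexAt E ξ ∈ (S \ T).val.map (cuspIndexAt E) := Multiset.mem_map.mpr ⟨ξ, hξST, rfl⟩
    rw [h0] at hmem
    exact Multiset.notMem_zero _ hmem
  · intro y hy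
    obtain ⟨x', hx', rfl⟩ := Multiset.mem_map.mp hy
    exact ⟨cuspIndexAt E ξ, Multiset.mem_map.mpr ⟨ξ, hξST, rfl⟩, hfib x' hx'⟩

end Campaign

/-! ## The rung: no infinite run of the typed procedure on the cusp staircase -/

section Rung

variable {n : ℕ} {p : ℕ} [Fact p.Prime] {K : Type u} [Field K] [CharP K p]
variable {N : Notions.{u} n} {A A' : AmbientDatum p K} {E : IdealExponent A.Z} {R : Resume N A E}

/-- [OURS · L1 W4.6 rung (iii); NOT a statement of the manuscript] **The typed Th. 16.6 procedure terminates on the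
cusp staircase**, for every notion instance and every reading: along a run all of whose stages lie in
`Regime.cuspCurve` the multisets `cuspMultiset (E_k)` would form an infinite descending chain in the Dershowitz–Manna
order on `Multiset ℕ`, which is well founded (Mathlib `Multiset.wellFounded_isDershowitzMannaLT`). [folklore] -/
theorem terminates_cuspCurve (N : Notions.{u} n) (Rd : Reading p K N) :
    Terminates N Rd (Regime.cuspCurve (p := p) (K := K)) := by
  intro r hr
  have hlt : ∀ k, Multiset.IsDershowitzMannaLT (cuspMultiset (r.E (k + 1))) (cuspMultiset (r.E k)) := by
    intro k
    have hfin : (r.E (k + 1)).sing.Finite := (hr (k + 1)).2.1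
    rw [r.E_succ k] at hfin ⊢
    exact (r.step k).isDershowitzMannaLT_cuspMultiset (hr k) hfin
  exact (wellFounded_iff_isEmpty_descending_chain.mp
    (Multiset.wellFounded_isDershowitzMannaLT (α := ℕ))).false ⟨fun k => cuspMultiset (r.E k), hlt⟩

/-- [OURS · L1 W4.6 rung (iii); NOT a statement of the manuscript] the ∇-CENTRED reading (the repaired «hence
terminates», `TerminatesNabla`, shared module v2/v3): no infinite ∇-centred run stays in `Regime.cuspCurve`
(anchor `terminatesNabla_of_terminates`). [folklore] -/
theorem terminatesNabla_cuspCurve (N : Notions.{u} n) (Rd : Reading p K N) :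
    TerminatesNabla N Rd (Regime.cuspCurve (p := p) (K := K)) :=
  terminatesNabla_of_terminates (terminates_cuspCurve N Rd)

/-- [OURS · L1 W4.6 rung (iii)] **`CuspCurveDescent` holds** (every `p`, `K`). [folklore] -/
theorem cuspCurveDescent_holds (p : ℕ) [Fact p.Prime] (K : Type u) [Field K] [CharP K p] :
    CuspCurveDescent p K :=
  fun _ _ _ _ _ _ s hRg hfin' => s.isDershowitzMannaLT_cuspMultiset hRg hfin'

/-- [OURS · L1 W4.6 rung (iii)] **The rung `CuspCurveTerminates` holds** (every `p`, `K`). [folklore] -/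
theorem cuspCurveTerminates_holds (p : ℕ) [Fact p.Prime] (K : Type u) [Field K] [CharP K p] :
    CuspCurveTerminates p K :=
  fun _ N Rd => terminates_cuspCurve N Rd

/-! ## The window is the first landing of the staircase -/

/-- A Moh-window germ (`b < d < 2b`) is a cusp germ off the `b`-th-power locus (`b ∤ d`). [folklore] -/
theorem MohWindowAt.cuspAt {b : ℕ} {S : Type u} [CommRing S] [IsLocalRing S] {I : Ideal S}
    (h : MohWindowAt b S I) : CuspAt b S I := by
  obtain ⟨hreg, hdim, x, y, hxy, d, u, hu, hbd, hd2, hI⟩ := h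
  refine ⟨d, ?_, hreg, hdim, x, y, hxy, u, hu, hI⟩
  rintro ⟨k, hk⟩
  rcases Nat.lt_or_ge k 2 with hk2 | hk2
  · interval_cases k <;> omega
  · have := Nat.mul_le_mul_left b hk2
    omega

/-- The window regime is contained in the staircase regime at every singular state (the exponent is positive by
`MohWindow.pos_of_mohWindowAt`). [folklore] -/
theorem Regime.cuspCurve_of_mohWindowCurve (h : Regime.mohWindowCurve A E) (hne : E.sing.Nonempty) :
    Regime.cuspCurve A E := by
  obtain ⟨hfin, hcl, hwin⟩ := h
  obtain ⟨ξ, hξ⟩ := hne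
  exact ⟨MohWindow.pos_of_mohWindowAt (hwin ξ hξ), hfin, hcl, fun ζ hζ => (hwin ζ hζ).cuspAt⟩

/-- [OURS · L1 W4.6 rung (iii), boundary refined; NOT a statement of the manuscript] **Outside the window the step
reproduces a cusp one stair down** (K4.6's chains `K_{p,n} → K_{p,n−p}`, rider «CuspStringStall»): if a step of the
typed procedure blows up the closed point `ξ` with `J_ξ` a cusp germ of exponents `(b, d)`, `b = E.b ≥ 1`, `d ≥ 2b`,
`b ∤ d`, then some point `x′ ∈ Sing(E′)` over `ξ` carries a cusp germ of exponents `(b, d − b)` (existence: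
`Step.exists_mem_sing_over_of_le` of `…MohWindowBoundary`; shape: `Cusp.cuspShape_transform_of_le`). [folklore] -/
theorem Step.exists_cuspShape_over_of_le (s : Step R A') {ξ : A.Z} (hD : (s.D : Set A.Z) = {ξ})
    (hξ : IsClosed ({ξ} : Set A.Z)) {d : ℕ} (hb : 1 ≤ E.b) (hbd : 2 * E.b ≤ d) (hnd : ¬ E.b ∣ d)
    (hW : CuspShape E.b d (A.Z.presheaf.stalk ξ) (stalkIdeal E.J ξ)) :
    ∃ x' ∈ s.E'.sing, s.π.base x' = ξ ∧
      CuspAt E.b (A'.Z.presheaf.stalk x') (stalkIdeal s.E'.J x') ∧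
      CuspShape E.b (d - E.b) (A'.Z.presheaf.stalk x') (stalkIdeal s.E'.J x') := by
  classical
  haveI : IsLocallyNoetherian A'.Z := by
    haveI := A'.smooth
    exact LocallyOfFiniteType.isLocallyNoetherian A'.hom
  obtain ⟨hreg, hdim, x, y, hxy, u, hu, hJ⟩ := hW
  haveI := hreg
  obtain ⟨c, hc_def⟩ : ∃ c : Fin 2 → A.Z.presheaf.stalk ξ, c = ![x, y] := ⟨_, rfl⟩
  have hc0 : c 0 = x := by rw [hc_def]; rfl
  have hc1 : c 1 = y := by rw [hc_def]; rfl
  have hc : Ideal.span (Set.range c) = maximalIdeal _ := by rw [hc_def, MohWindow.range_vec2]; exact hxy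
  have hJc : stalkIdeal E.J ξ = Ideal.span {c 1 ^ E.b + u * c 0 ^ d} := by rw [hJ, hc0, hc1]
  obtain ⟨x', hx', hπx'⟩ := s.exists_mem_sing_over_of_le hD hξ hdim c hc hb hbd hJc
  refine ⟨x', hx', hπx', ?_⟩
  subst hπx'
  have hY : stalkIdeal (vanishingIdeal s.D) (s.π.base x') =
      maximalIdeal (A.Z.presheaf.stalk (s.π.base x')) := by
    apply stalkIdeal_vanishingIdeal_eq_maximalIdeal_of_closure_eq
    rw [hD, hξ.closure_eq]
  have hx'b : (E.b : ℕ∞) ≤ idealOrder (controlledTransform s.π (vanishingIdeal s.D) E.J E.b) x' := hx'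
  have hshape' := Cusp.cuspShape_transform_of_le s.blowup hb (by omega) hY
    ⟨hreg, hdim, x, y, hxy, u, hu, hJ⟩ hx'b
  have hnd' : ¬ E.b ∣ (d - E.b) := fun h => hnd (by
    have h2 := dvd_add h (dvd_refl E.b)
    rwa [Nat.sub_add_cancel (by omega : E.b ≤ d)] at h2)
  exact ⟨⟨_, hnd', hshape'⟩, hshape'⟩

end Rung

end CampaignW46

end Summit.ResolutionOfSingularities.ResolutionOfSingularities.Theorems

end
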